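import Summits.BirchSwinnertonDyer.Rank1Residual.X11b.CWFrameValueRigidity
import Summits.BirchSwinnertonDyer.Rank1Residual.X11b.FrameIdealRigidity
import HarnessLib

/-!
# Stub S1 `stub_bdpLowerHalfRatSS` of line `bdpline` (crux `AnticyclotomicEisensteinDivisibility`,
# stmt-BirchSwinnertonDyer-20727) — helper B: the NORMALISATION CONCORDANCE between Castella–Wan's
# BDP frame (`IsCWBDPLFunction`, Prop. 2.1) and Castella's (`IsBDPLFunction`, Thm. 3.1) AT THE LEVEL OF
# IDEALS of `𝓞_{ℂ_p}⟦T⟧`: the two `p`-adic `L`-functions differ by a UNIT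

Width seat bsd-line-sbc-p1-w2 (gen 5), `--supports stmt-BirchSwinnertonDyer-20727`. The module docstring
of `Literature/…/CastellaWan2024/GreenbergMainConjectureBDP.lean` records as item (b), "printed nowhere",
the normalisation concordance between Prop. 2.1's `𝓛_𝔭^BDP` and Castella 2018 Thm. 3.1's `L_p(f)` — "a
consumer phrased over `IsBDPLFunction` still carries it as a binder". S1 is phrased over `IsBDPLFunction`
(every frame), while the refereed Castella–Wan inputs that the Eisenstein-direction transfer
(`Theorems/…EisensteinTransfer.lean`, p634573) consumes deliver an `IsCWBDPLFunction` frame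
(`AcSigned.castellaWan2024_proofThm68_transferInputs`). THIS FILE REMOVES THAT BINDER as a kernel theorem:
over an imaginary quadratic `K`, at an odd `p` with `p ∤ N` and `p ∤ D`, for an anticyclotomic `κ` with
topological generator `γ`, ANY `IsCWBDPLFunction ι 𝔭 κ γ f D Ω_K Ω_p L_W` and ANY
`IsBDPLFunction ι 𝔭 κ γ f Ω_K' Ω_p' L_C` with non-zero periods satisfy `L_W = U · L_C` in `𝓞_{ℂ_p}⟦T⟧` for
a UNIT `U`; hence they generate the same ideal there (and along every structure map `J₀ : R₀ → 𝓞_{ℂ_p}`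
compatible with `R₀ ⊂ ℂ_p`, the currency of S1).

## Proof (all ingredients are tree theorems)

`X11b.hasValueAt_cwFrame_rescale` (cell bsd-print-x6): at a common interpolation point of type `(n,−n)`
with `p − 1 ∣ n`, `L_W` takes the value `A·βⁿ·V_C`, `A = ι⁻¹(√D/8)`, `β = ι⁻¹(Ω_K'⁴/(4DΩ_K⁴))·(Ω_p/Ω_p')⁴`,
where `V_C` is the value of `L_C` (`cwInterpolationValue = (√D/8)(Ω_K'⁴/(4DΩ_K⁴))ⁿ·bdpInterpolationValue`).
Along the powers `φ₀^{Mj}`, `M = p^a(p−1)`, of the supply `LambdaSupply.exists_interpolationCharacter`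
(test points `x^j − 1`, `x = x₀^{M}` a principal unit with `‖x − 1‖ < p⁻¹`, `x ≠ 1` by
`R1.norm_pow_sub_one_of_coprime`), the series `C(A)·L_C` and `L_W` read in `𝓞_{ℂ_p}⟦T⟧` have values tied
by `b^j`, `b = β^{mM}`; `R1.exists_unit_mul_eq_of_values` (cell b2b-bsdres, the engine of
`R1.exists_unit_mul_eq_of_isBDPLFunctionInt`) gives `L_W = U·C(A)·L_C` with `U` a unit, and `A` is a
`p`-adic unit (`(ι⁻¹√D)² = D`, `‖D‖_p = ‖8‖_p = 1`).

## Contents (PROVED, standard axioms; no definition, no named fact, no `sorry`)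

* §1 `intSeries_hasValueAt_C_mul`, `isUnit_C_of_norm_eq_one` (bookkeeping in `𝓞_{ℂ_p}⟦T⟧`).
* §2 `exists_unit_mul_eq_of_isCWBDPLFunction_of_isBDPLFunction` (THE CONCORDANCE),
  `span_map_eq_of_isCWBDPLFunction_of_isBDPLFunction` (same ideal of `𝓞_{ℂ_p}⟦T⟧` along `R1.unrToCpInt`),
  `span_map_eq_of_isCWBDPLFunction_of_isBDPLFunction_of_coe_eq` (along any compatible `J₀`).
Nothing about any curve is asserted; BSD / the crux are not proved by this file. Serves also the `⊇` port of
crux stmt-BirchSwinnertonDyer-23594 (`TwinSplitIMCAtThreeGoodSSApZero`), which carries the same binder.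
-/

-- D-0017: single-problem summit, the namespace repeats the problem name by design.
set_option linter.dupNamespace false
set_option autoImplicit false

noncomputable section

open scoped Classical Topology

open Filter PowerSeries NumberField IsDedekindDomain Field
  Literature.NumberTheory.EllipticCurves Literature.NumberTheory.GaloisRepresentations
  Literature.NumberTheory.EllipticCurves.CastellaWan2024
  Summit.BirchSwinnertonDyer.Rank1Residual.X11b
  Summit.BirchSwinnertonDyer.Rank1Residual.X11b.Three.LambdaSupply
  Summit.BirchSwinnertonDyer.Rank1Residual.X11b.LambdaSupply

namespace Summit.BirchSwinnertonDyer.BirchSwinnertonDyer.Theorems.SignedBaseChangeAcDivFrameConcordance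

variable {p : ℕ} [Fact p.Prime]

/-! ### §1 Bookkeeping in `𝓞_{ℂ_p}⟦T⟧` -/

/-- The constant series `C a` has the value `a` at every point. [folklore] -/
theorem intSeries_hasValueAt_C (a : 𝓞_ℂ_[p]) (x : ℂ_[p]) :
    IntSeries.HasValueAt (PowerSeries.C a) x (a : ℂ_[p]) := by
  have h := hasSum_single (f := fun k : ℕ ↦
    ((PowerSeries.coeff k (PowerSeries.C a) : 𝓞_ℂ_[p]) : ℂ_[p]) * x ^ k) 0
    (fun k hk ↦ by rw [PowerSeries.coeff_C, if_neg hk, ZeroMemClass.coe_zero, zero_mul])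
  simpa [IntSeries.HasValueAt, PowerSeries.coeff_C] using h

/-- Values of `C a · Q`: `a` times the values of `Q` (on the open unit disc). [folklore] -/
theorem intSeries_hasValueAt_C_mul {Q : PowerSeries 𝓞_ℂ_[p]} (a : 𝓞_ℂ_[p]) {x v : ℂ_[p]}
    (hx : ‖x‖ < 1) (hQ : IntSeries.HasValueAt Q x v) :
    IntSeries.HasValueAt (PowerSeries.C a * Q) x ((a : ℂ_[p]) * v) :=
  intSeries_hasValueAt_mul hx (intSeries_hasValueAt_C a x) hQ

/-- An element of `ℂ_p` of norm `1` is a unit of `𝓞_{ℂ_p}`, and so is the constant series it defines.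
[folklore] -/
theorem isUnit_C_of_norm_eq_one {A : ℂ_[p]} (hA : ‖A‖ = 1) :
    ∃ a : 𝓞_ℂ_[p], (a : ℂ_[p]) = A ∧ IsUnit (PowerSeries.C a) := by
  have hA0 : A ≠ 0 := norm_ne_zero_iff.mp (by rw [hA]; exact one_ne_zero)
  let a : 𝓞_ℂ_[p] := ⟨A, Literature.NumberTheory.LFunctions.Dwork.mem_unitBall.mpr hA.le⟩
  let a' : 𝓞_ℂ_[p] :=
    ⟨A⁻¹, Literature.NumberTheory.LFunctions.Dwork.mem_unitBall.mpr (by rw [norm_inv, hA, inv_one])⟩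
  have haa' : a * a' = 1 := Subtype.ext (mul_inv_cancel₀ hA0)
  refine ⟨a, rfl, ?_⟩
  exact (IsUnit.of_mul_eq_one a' haa').map PowerSeries.C

/-- `‖ι⁻¹(√D/8)‖ = 1` in `ℂ_p` when `p ∤ 2D` (`(ι⁻¹√D)² = D` has norm `1`, `‖8‖_p = 1` at odd `p`) — the
computation of `X11b.norm_coe_constantCoeff_eq_of_isCWBDPLFunction_of_isBDPLFunction`.
[cite: CastellaWan2023, Prop. 2.1 (MS p. 6)] -/
theorem norm_coe_symm_sqrt_div_eight (hp2 : p ≠ 2) (ι : PadicAlgCl p ≃+* ℂ) {D : ℤ}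
    (hpD : ¬ (p : ℤ) ∣ D) :
    ‖((ι.symm ((D : ℂ) ^ ((2 : ℂ)⁻¹) / 8) : PadicAlgCl p) : ℂ_[p])‖ = 1 := by
  have hp : p.Prime := Fact.out
  rw [PadicComplex.norm_extends, map_div₀, norm_div]
  have hs : ‖ι.symm ((D : ℂ) ^ ((2 : ℂ)⁻¹))‖ = 1 := by
    have hsqC : ((D : ℂ) ^ ((2 : ℂ)⁻¹)) ^ 2 = (D : ℂ) := by simp
    have hsq : (ι.symm ((D : ℂ) ^ ((2 : ℂ)⁻¹))) ^ 2 = algebraMap ℚ_[p] (PadicAlgCl p) (D : ℚ_[p]) := by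
      rw [← map_pow, hsqC, map_intCast, map_intCast]
    have h1 : ‖ι.symm ((D : ℂ) ^ ((2 : ℂ)⁻¹))‖ ^ 2 = 1 := by
      rw [← norm_pow, hsq, PadicAlgCl.norm_extends]
      exact le_antisymm (Padic.norm_int_le_one D)
        (not_lt.mp (mt Padic.norm_intCast_lt_one_iff.mp hpD))
    exact (pow_eq_one_iff_of_nonneg (norm_nonneg _) two_ne_zero).mp h1
  have h8 : ‖ι.symm (8 : ℂ)‖ = 1 := by
    have e8 : ι.symm (8 : ℂ) = algebraMap ℚ_[p] (PadicAlgCl p) ((8 : ℕ) : ℚ_[p]) := by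
      rw [map_natCast, map_ofNat]; norm_num
    rw [e8, PadicAlgCl.norm_extends, Padic.norm_natCast_eq_one_iff]
    have h2 : p.Coprime 2 := (Nat.coprime_primes hp Nat.prime_two).mpr hp2
    have h3 : p.Coprime (2 ^ 3) := h2.pow_right 3
    norm_num at h3
    exact h3
  rw [hs, h8, div_one]

/-! ### §2 The concordance -/

section Concordance

variable {K : Type} [Field K] [NumberField K] {N : ℕ} {ι : PadicAlgCl p ≃+* ℂ}
  {𝔭 : HeightOneSpectrum (𝓞 K)} {κ : ZpExtension K p} {γ : Field.absoluteGaloisGroup K}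
  {f : CuspForm (CongruenceSubgroup.Gamma0 N) 2} {D : ℤ} {ΩK ΩK' : ℂ} {Ωp Ωp' : ℂ_[p]}
  {LW LC : UnrSeries p}

/-- **THE NORMALISATION CONCORDANCE `IsCWBDPLFunction` ↔ `IsBDPLFunction`: the two frames differ by a
unit of `𝓞_{ℂ_p}⟦T⟧`.** Over an imaginary quadratic `K`, for `κ` anticyclotomic with topological generator
`γ`, `p ≠ 2`, `p ∤ N` (the level of `f`), `p ∤ D`, and non-zero periods: if
`IsCWBDPLFunction ι 𝔭 κ γ f D Ω_K Ω_p L_W` (Castella–Wan 2024 Prop. 2.1's frame) and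
`IsBDPLFunction ι 𝔭 κ γ f Ω_K' Ω_p' L_C` (Castella 2018 Thm. 3.1's frame) for the SAME `(ι, 𝔭, κ, γ, f)`,
then `L_W = U · L_C` in `𝓞_{ℂ_p}⟦T⟧` for a unit `U`. Proof: module docstring (test points the powers
`φ₀^{p^a(p−1)j}` of the interpolation character, values tied by `A·b^j`, `R1.exists_unit_mul_eq_of_values`,
`A = ι⁻¹(√D/8)` a `p`-adic unit). [cite: CastellaWan2023, Prop. 2.1 and (2.1)–(2.2) (MS pp. 5–8)]
[cite: Castella2018, Thm. 3.1 (arXiv:1704.06608 p. 9)] [cite: Washington1997, §5.1] -/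
theorem exists_unit_mul_eq_of_isCWBDPLFunction_of_isBDPLFunction (hp2 : p ≠ 2)
    (hK : IsImaginaryQuadratic K) (hκa : κ.IsAnticyclotomic) (hγ : κ.IsTopGenerator γ)
    (hpN : ¬ p ∣ N) (hpD : ¬ (p : ℤ) ∣ D) (hΩK : ΩK ≠ 0) (hΩK' : ΩK' ≠ 0) (hΩp : Ωp ≠ 0)
    (hΩp' : Ωp' ≠ 0) (hW : IsCWBDPLFunction ι 𝔭 κ γ f D ΩK Ωp LW)
    (hC : IsBDPLFunction ι 𝔭 κ γ f ΩK' Ωp' LC) :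
    ∃ U : PowerSeries 𝓞_ℂ_[p], IsUnit U ∧
      PowerSeries.map (R1.unrToCpInt p) LW = U * PowerSeries.map (R1.unrToCpInt p) LC := by
  have hp : p.Prime := Fact.out
  have hD : D ≠ 0 := by rintro rfl; exact hpD (dvd_zero _)
  -- the supply: `φ₀` of type `(m, −m)`, avatar `e ∘ ψ` through `κ`, `x₀ = ψ(γ)` a principal unit
  obtain ⟨φ₀, m, ψ, hm, hunr, hinf, hav, hfac, hx1, hne⟩ :=
    LambdaSupply.exists_interpolationCharacter hp2 ι K κ hK hκa γ hγ
  set e := (FramedRep.unitsContinuousMulEquivOfUnique (Fin 1) (PadicAlgCl p) :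
    (PadicAlgCl p)ˣ →ₜ* GL (Fin 1) (PadicAlgCl p)) with he
  set x₀ : ℂ_[p] := avatarValueAt (e.comp ψ) γ with hx₀
  have hunr' : ∀ v : HeightOneSpectrum (𝓞 K), ((p : ℕ) : 𝓞 K) ∉ v.asIdeal → φ₀.IsUnramifiedAt v :=
    fun v _ => hunr v
  have hpow_unr : ∀ (j : ℕ) (v : HeightOneSpectrum (𝓞 K)), (φ₀ ^ j).IsUnramifiedAt v :=
    fun j v => isUnramifiedAt_pow' (hunr v) j
  have hpow_inf : ∀ j : ℕ, (φ₀ ^ j).HasInfinityType (fun _ ↦ ((m * j : ℕ) : ℤ))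
      (fun _ ↦ -((m * j : ℕ) : ℤ)) := fun j => by
    have h := HasInfinityType.pow_nat hinf j
    convert h using 2 <;> push_cast <;> ring_nf
  have hpow_av : ∀ j : ℕ, IsPAdicAvatarOf ι (φ₀ ^ j) (e.comp (ψ ^ j)) :=
    fun j => isPAdicAvatarOf_pow ι hav hunr' j
  have hpow_fac : ∀ j : ℕ, FactorsThroughZp κ (e.comp (ψ ^ j)) :=
    fun j => factorsThroughZp_unitsChar_pow κ hfac j
  have hpow_val : ∀ j : ℕ, avatarValueAt (e.comp (ψ ^ j)) γ = x₀ ^ j :=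
    fun j => avatarValueAt_unitsChar_pow ψ γ j
  -- `a` with `‖x₀^{p^a} − 1‖ < p⁻¹`; `M = p^a (p - 1)`, `x = x₀^M`
  have hpinv : 0 < (p : ℝ)⁻¹ := inv_pos.mpr (by exact_mod_cast hp.pos)
  obtain ⟨a, ha⟩ : ∃ a : ℕ, ‖x₀ ^ p ^ a - 1‖ < (p : ℝ)⁻¹ := by
    have h := tendsto_pow_prime_pow_padicComplex (p := p) hx1
    have hev := h.eventually (Metric.ball_mem_nhds (1 : ℂ_[p]) hpinv)
    obtain ⟨a, ha⟩ := hev.exists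
    exact ⟨a, by rwa [dist_eq_norm] at ha⟩
  have hp1 : 0 < p - 1 := by have := hp.two_le; omega
  have hcop : p.Coprime (p - 1) := by
    rw [Nat.coprime_self_sub_right hp.one_lt.le]
    exact Nat.coprime_one_right p
  set M : ℕ := p ^ a * (p - 1) with hM
  have hMpos : 0 < M := Nat.mul_pos (pow_pos hp.pos a) hp1
  set x : ℂ_[p] := x₀ ^ M with hxdef
  have hxa1 : ‖x₀ ^ p ^ a - 1‖ < 1 := ha.trans (inv_lt_one_of_one_lt₀ (by exact_mod_cast hp.one_lt))
  have hxeq : ‖x - 1‖ = ‖x₀ ^ p ^ a - 1‖ := by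
    rw [hxdef, hM, pow_mul]
    exact R1.norm_pow_sub_one_of_coprime hxa1 hcop
  have hx : ‖x - 1‖ < (p : ℝ)⁻¹ := by rw [hxeq]; exact ha
  have hxlt : ‖x - 1‖ < 1 := by rw [hxeq]; exact hxa1
  have hxne : x ≠ 1 := by
    intro h1
    have h0 : ‖x₀ ^ p ^ a - 1‖ = 0 := by rw [← hxeq, h1, sub_self, norm_zero]
    exact hne a (sub_eq_zero.mp (norm_eq_zero.mp h0))
  -- types `n_j = m M j`, with `p - 1 ∣ n_j` and `n_j > 0` for `j ≥ 1`
  have hdvd : ∀ j, (p - 1) ∣ m * (M * j) := fun j ↦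
    Dvd.dvd.mul_left (Dvd.dvd.mul_right (Dvd.intro_left _ rfl) _) _
  have hpt : ∀ j : ℕ, ‖x ^ j - 1‖ < 1 := fun j => (R1.norm_pow_sub_one_le hxlt j).trans_lt hxlt
  -- the two series read in `𝓞_{ℂ_p}⟦T⟧`, and the constant `A`
  set QC : PowerSeries 𝓞_ℂ_[p] := PowerSeries.map (R1.unrToCpInt p) LC with hQC
  set QW : PowerSeries 𝓞_ℂ_[p] := PowerSeries.map (R1.unrToCpInt p) LW with hQW
  set A : ℂ_[p] := ((ι.symm ((D : ℂ) ^ ((2 : ℂ)⁻¹) / 8) : PadicAlgCl p) : ℂ_[p]) with hA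
  obtain ⟨aA, haA, hunitA⟩ := isUnit_C_of_norm_eq_one (norm_coe_symm_sqrt_div_eight hp2 ι hpD)
  set Q : PowerSeries 𝓞_ℂ_[p] := PowerSeries.C aA * QC with hQ
  -- generic values of `Q`, `QW` at the points `x^j − 1`
  choose V hV using fun j : ℕ => intSeries_exists_hasValueAt Q (hpt j)
  choose V' hV' using fun j : ℕ => intSeries_exists_hasValueAt QW (hpt j)
  -- the ratio
  set β : ℂ_[p] := ((ι.symm (ΩK' ^ 4 / (4 * D * ΩK ^ 4)) : PadicAlgCl p) : ℂ_[p]) * (Ωp / Ωp') ^ 4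
    with hβ
  have hDC : (D : ℂ) ≠ 0 := by exact_mod_cast hD
  have hβ0 : β ≠ 0 := by
    refine mul_ne_zero ?_ (pow_ne_zero _ (div_ne_zero hΩp hΩp'))
    rw [PadicComplex.coe_eq]
    exact (map_ne_zero_iff _ (algebraMap (PadicAlgCl p) ℂ_[p]).injective).mpr
      ((map_ne_zero_iff _ ι.symm.injective).mpr (div_ne_zero (pow_ne_zero _ hΩK')
        (mul_ne_zero (mul_ne_zero (by norm_num) hDC) (pow_ne_zero _ hΩK))))
  set b : ℂ_[p] := β ^ (m * M) with hbdef
  have hb : b ≠ 0 := pow_ne_zero _ hβ0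
  -- the relation `V' j = b^j V j` for `j ≥ 1`, through the characters `φ₀^{M j}`
  have hrel : ∀ j, 0 < j → V' j = b ^ j * V j := by
    intro j hj
    have hn : 0 < m * (M * j) := Nat.mul_pos hm (Nat.mul_pos hMpos hj)
    have hvalj : avatarValueAt (e.comp (ψ ^ (M * j))) γ = x ^ j := by
      rw [hpow_val, hxdef, ← pow_mul]
    -- Castella's frame at `φ₀^{Mj}`
    have h1 := hC (φ₀ ^ (M * j)) (m * (M * j)) hn (hpow_unr (M * j)) (hpow_inf (M * j))
      (e.comp (ψ ^ (M * j))) (hpow_av (M * j)) (hpow_fac (M * j))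
    rw [hvalj] at h1
    have h1' : IntSeries.HasValueAt Q (x ^ j - 1) (A *
        (((ι.symm (bdpInterpolationValue p f 𝔭 (φ₀ ^ (M * j)) (m * (M * j)) ΩK') : PadicAlgCl p) :
          ℂ_[p]) * Ωp' ^ (4 * (m * (M * j))))) := by
      rw [hQ, hA, ← haA]
      exact intSeries_hasValueAt_C_mul aA (hpt j) ((R1.intSeries_hasValueAt_map_iff p LC _ _).mpr h1)
    -- Castella–Wan's frame at `φ₀^{Mj}`
    have h2 := hasValueAt_cwFrame_rescale hpN hD hΩK hΩK' hΩp' hW hn (hdvd j) (hpow_unr (M * j))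
      (hpow_inf (M * j)) (hpow_av (M * j)) (hpow_fac (M * j))
    rw [hvalj] at h2
    have h2' := (R1.intSeries_hasValueAt_map_iff p LW _ _).mpr h2
    have e1 : V j = _ := (hV j).unique h1'
    have e2 : V' j = _ := (hV' j).unique h2'
    rw [e2, e1, hbdef, ← hβ, ← hA, ← pow_mul, show m * M * j = m * (M * j) by ring]
    ring
  -- ideal rigidity across the two frames
  obtain ⟨U, hU, hUQ⟩ := R1.exists_unit_mul_eq_of_values hx hxne hb hV hV' hrel
  refine ⟨U * PowerSeries.C aA, hU.mul hunitA, ?_⟩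
  rw [hUQ, hQ, mul_assoc]

/-- **The two frames generate the same ideal of `𝓞_{ℂ_p}⟦T⟧`** (read along `R1.unrToCpInt : R₀ → 𝓞_{ℂ_p}`).
[cite: CastellaWan2023, Prop. 2.1 (MS p. 6)] [cite: Castella2018, Thm. 3.1 (arXiv:1704.06608 p. 9)] -/
theorem span_map_eq_of_isCWBDPLFunction_of_isBDPLFunction (hp2 : p ≠ 2)
    (hK : IsImaginaryQuadratic K) (hκa : κ.IsAnticyclotomic) (hγ : κ.IsTopGenerator γ)
    (hpN : ¬ p ∣ N) (hpD : ¬ (p : ℤ) ∣ D) (hΩK : ΩK ≠ 0) (hΩK' : ΩK' ≠ 0) (hΩp : Ωp ≠ 0)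
    (hΩp' : Ωp' ≠ 0) (hW : IsCWBDPLFunction ι 𝔭 κ γ f D ΩK Ωp LW)
    (hC : IsBDPLFunction ι 𝔭 κ γ f ΩK' Ωp' LC) :
    Ideal.span {PowerSeries.map (R1.unrToCpInt p) LW} =
      Ideal.span {PowerSeries.map (R1.unrToCpInt p) LC} := by
  obtain ⟨U, hU, hUQ⟩ := exists_unit_mul_eq_of_isCWBDPLFunction_of_isBDPLFunction hp2 hK hκa hγ hpN
    hpD hΩK hΩK' hΩp hΩp' hW hC
  rw [hUQ]
  exact Ideal.span_singleton_mul_left_unit hU _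

/-- **The same along ANY structure map `J₀ : R₀ → 𝓞_{ℂ_p}` compatible with `R₀ ⊂ ℂ_p`** (the currency of
S1: `Ideal.span {PowerSeries.map J₀ L}`); such a `J₀` IS `R1.unrToCpInt` (`𝓞_{ℂ_p} ↪ ℂ_p` is injective).
[cite: CastellaWan2023, Prop. 2.1 (MS p. 6)] [cite: Castella2018, Thm. 3.1 (arXiv:1704.06608 p. 9)] -/
theorem span_map_eq_of_isCWBDPLFunction_of_isBDPLFunction_of_coe_eq (hp2 : p ≠ 2)
    (hK : IsImaginaryQuadratic K) (hκa : κ.IsAnticyclotomic) (hγ : κ.IsTopGenerator γ)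
    (hpN : ¬ p ∣ N) (hpD : ¬ (p : ℤ) ∣ D) (hΩK : ΩK ≠ 0) (hΩK' : ΩK' ≠ 0) (hΩp : Ωp ≠ 0)
    (hΩp' : Ωp' ≠ 0) (hW : IsCWBDPLFunction ι 𝔭 κ γ f D ΩK Ωp LW)
    (hC : IsBDPLFunction ι 𝔭 κ γ f ΩK' Ωp' LC)
    (J₀ : unrIntegers p →+* PadicComplexInt p)
    (hJ₀ : ∀ x : unrIntegers p, ((J₀ x : PadicComplexInt p) : ℂ_[p]) = (x : ℂ_[p])) :
    Ideal.span {PowerSeries.map J₀ LW} = Ideal.span {PowerSeries.map J₀ LC} := by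
  have hJ₀eq : J₀ = R1.unrToCpInt p :=
    RingHom.ext fun x ↦ Subtype.ext ((hJ₀ x).trans (R1.coe_unrToCpInt p x).symm)
  subst hJ₀eq
  exact span_map_eq_of_isCWBDPLFunction_of_isBDPLFunction hp2 hK hκa hγ hpN hpD hΩK hΩK' hΩp hΩp' hW hC

end Concordance

end Summit.BirchSwinnertonDyer.BirchSwinnertonDyer.Theorems.SignedBaseChangeAcDivFrameConcordance

end
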